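import Summits.RiemannHypothesis.RiemannHypothesis.Theorems.TiltedLandingLaw421R3BotQ
import Summits.RiemannHypothesis.RiemannHypothesis.Theses.EarlyAppointments

/-! # trkD_v3q — W-08 ROUND-3b LINE for crux `TiltedLandingLaw421` (stmt-RiemannHypothesis-24774), director (CA334) OPTION (Q) (2026-08-30T05:08Z):
the round-3 seal-free REST (OPTION B of (CA328): β(⊥) split into its two literal rate conjuncts, node `law421T_of_alphaFree`) RE-KEYED on the
QUADRATIC-WINDOW (MARKOV) LINEAGE `RhW08.QuadW.StTrkDQ` — tracked states are the non-real zeros `u` of `f⁽ʲ⁾` with `0 < Im u ≤ Hs` in the window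
`(u.re − x₀)² + j·(u.im)² ≤ j·Hs²` that HANG UNDER SOME Q-state `v` of level `j−1` (`(u.re − v.re)² + u.im² ≤ v.im²`, the closed Jensen disc of `v`; level 0 = the column),
a window that is STEP-STABLE under Jensen-nested steps (`RhW08.QuadW.quad_step'`; C1 `RhW08.QuadWindow.quad_step`) — replacing the linear window `R/2 + j·(s/4)` of `StCol'`,
which C6 ADD-86 frame A (f = (z²+169/400)·∏(z−2−i/4), s = 0.02, Hs = 0.655, R = 2; replicated ×4) leaves at level 6 with the level charged and unready ((CA333) HOLD).
STUBS (2): `stub_restSuccBotQ : RhW08.SealSwapQ.RestSuccBotQ` — (S♮)^Q «no silent extinction»: every charged level `j` of `PTrkSQ PBot` has an inhabited tracked Q-level `j+1`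
           (= SOME non-real zero of `f⁽ʲ⁺¹⁾` with `Im ≤ Hs` in the closed Jensen disc of SOME Q-state of level `j`);
           `stub_restRateBotQ : RhW08.SealSwapQ.RestRateBotQ` — (R)^Q the rate inequality ∀ k: charged count + unspent root credit + 4·lowH k/s + free drops/(s/4) ≤ (Hs/s)² + B + 1 + 4hmax/s.
COMPOSITION (0 sorry outside the stubs): `RhW08.SealSwapQ.law421T_of_succ_rateQ` (= `law421T_of_alphaFreeQ ∘ zRestTrkSBot_of_succ_rateQ`, C4 §K.29, PROVED) ⇒ the ROUTE DECL BY NAME.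
NO α stub; INIT♯^Q `RestInitBotQ` is the `k = 0` instance of stub 2 (`restInitBot_of_rateQ`), a helper. C1 image (rh-idea-5 g24) over C4 g26 §K.29 (typing (ii′), WORDS-58b) —
NOT keyed, NOT registered (registration = lead on a director line, after (CA334)(b) pricing). Supersedes the un-born `trkD_v3bot.lean` (d5f82603; its stub 1 `RestSuccBot` is false
in model on frame A) and `trkD_v2R.lean` (d97327ed; `stub_alphaSealTrkD'` kernel-false, `alphaSealTrkD'_false`). Typed ≠ proved; models (combs) ≠ ξ; RH is NOT proved. -/

namespace Summit.RiemannHypothesis.RiemannHypothesis.Cruxes.TiltedLandingLaw421.TrkDV3Q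

set_option linter.dupNamespace false

/-- STUB 1 (S♮ over the Q-lineage, seal-free) — `RhW08.SealSwapQ.RestSuccBotQ`: on every legal frame every charged level `j` of `PTrkSQ PBot` (lowest tracked Q-state not
Ready′, no tracked Q-state of level `j+1` at least `s/4` lower) has an inhabited tracked Q-level `j+1`. -/
theorem stub_restSuccBotQ : RhW08.SealSwapQ.RestSuccBotQ := by
  sorry

/-- STUB 2 (R over the Q-lineage, seal-free signed REST at the booked-root meter) — `RhW08.SealSwapQ.RestRateBotQ`: on every legal frame, ∀ k,
`chargeCount k + (T₀ᴿ − injected k)⁺ + 4·lowH k/s + Σ_{j<k}[¬Charged j] 4(lowH j − lowH (j+1))/s ≤ (Hs/s)² + B + 1 + 4·hmax/s`. -/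
theorem stub_restRateBotQ : RhW08.SealSwapQ.RestRateBotQ := by
  sorry

/-- **COMPOSITION** — the two stub statements prove the crux `TiltedLandingLaw421` (route `EarlyAppointments`, stmt-RiemannHypothesis-24774) BY NAME:
`law421T_of_succ_rateQ hS hR` (= `law421T_of_alphaFreeQ (zRestTrkSBot_of_succ_rateQ hS hR)`). -/
theorem TiltedLandingLaw421_of : RhW08.SealSwapQ.RestSuccBotQ → RhW08.SealSwapQ.RestRateBotQ →
    Summit.RiemannHypothesis.RiemannHypothesis.Theses.EarlyAppointments.TiltedLandingLaw421 :=
  fun hS hR => RhW08.SealSwapQ.law421T_of_succ_rateQ hS hR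

/-- (K) the crux itself, from the registered stubs through the composition. -/
theorem tiltedLandingLaw421 : Summit.RiemannHypothesis.RiemannHypothesis.Theses.EarlyAppointments.TiltedLandingLaw421 :=
  TiltedLandingLaw421_of stub_restSuccBotQ stub_restRateBotQ

end Summit.RiemannHypothesis.RiemannHypothesis.Cruxes.TiltedLandingLaw421.TrkDV3Q
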